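import Mathlib
import Summits.AtomisticToContinuum.Crystallization.Theses.PhononSlackCertificates
import Summits.AtomisticToContinuum.Crystallization.Theorems.PhononSlackCertificatesAllBadGapFloor
import Summits.AtomisticToContinuum.Crystallization.Theorems.PhononSlackCertificatesFarFieldGapRDecomp

/-!
# Route `PhononSlackCertificates`, crux `NearFieldConvexity` (stmt-AtomisticToContinuum-13958), line `Sketch`:
stub `stub_cruxOfPureNearField` — the far field removed

With the INTERFACE LEMMA in hand (`stub_interfaceOfPairCount ∘ stub_pairCountOfCrossing ∘
stub_segmentCrossing`, landed), the crux `NearFieldConvexity` is reduced to its PURE NEAR-FIELD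
form: the same inequality with the SELF-ENERGY of `Ω` in place of the full site energies,
`c·#NL(Ω) − C·#∂₄Ω ≤ Σ_{i∈Ω} ½Σ_{j∈Ω∖i} V(|x i − x j|) − #Ω · e*` (no matter outside `Ω` enters the
right side; the configuration outside `Ω` matters only through the goodness and layeredness
predicates of the particles of `Ω`).  Indeed `Σ_{i∈Ω} e_i = (self part) + ½·cross`, and the cross
terms with `Ωᶜ` are `≥ −(250/12)δ⁻⁶` at a boundary site (shell sum) and, summed over the radius-4
interior, `≥ −(K(δ)/12)·#∂₄Ω` by the interface lemma (`V_LJ ≥ −r⁻⁶/6`).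

Also recorded: the self part is `≥ 0` by periodisation (`pureNearField_self_floor`), hence the
BOUNDARY FLOOR `Σ_{i∈Ω}(e_i − e*) ≥ −C(δ)·#∂₄Ω` (`boundaryFloor`, the `c = 0` shadow of the crux,
asked for by the crux's disprover) holds unconditionally given the interface lemma.
-/

noncomputable section

open scoped BigOperators
open Literature.MathematicalPhysics.StatisticalMechanics Literature.Geometry.DiscreteGeometry

namespace Summit.AtomisticToContinuum.Crystallization.Theorems.PhononSlackNearFieldConvexity

open Summit.AtomisticToContinuum.Crystallization.Theorems.PhononSlackCertificatesAllBadGapFloor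
  (neg_inv_pow_six_le_lennardJones injective_of_separated card_mul_iInf_le_interactionEnergy)
open Summit.AtomisticToContinuum.Crystallization.Theorems.PhononSlackCertificatesFarFieldGapR
  (stub_decomp)

/-- Splitting a site sum at a member of `Ω`: `Σ_{j ≠ i} f = Σ_{j ∈ Ω∖i} f + Σ_{j ∉ Ω} f`. [folklore] -/
theorem pnf_sum_erase_split {N : ℕ} (Ω : Finset (Fin N)) {i : Fin N} (hi : i ∈ Ω) (f : Fin N → ℝ) :
    ∑ j ∈ Finset.univ.erase i, f j =
      ∑ j ∈ Ω.erase i, f j + ∑ j ∈ Finset.univ.filter (fun j => j ∉ Ω), f j := by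
  classical
  have h1 : ∑ j ∈ Finset.univ.erase i, f j = ∑ j, f j - f i :=
    Finset.sum_erase_eq_sub (f := f) (Finset.mem_univ i)
  have h2 : ∑ j ∈ Ω.erase i, f j = ∑ j ∈ Ω, f j - f i := Finset.sum_erase_eq_sub (f := f) hi
  have h3 : ∑ j, f j = ∑ j ∈ Ω, f j + ∑ j ∈ Finset.univ.filter (fun j => j ∉ Ω), f j := by
    rw [← Finset.sum_filter_add_sum_filter_not Finset.univ (fun j => j ∈ Ω)]
    congr 2
    ext j
    simp
  linarith

/-- The self part of the site-energy sum over `Ω` is the interaction energy of the sub-configuration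
indexed by `Ω` (via `stub_decomp` with the order embedding of `Ω`). [folklore] -/
theorem pnf_self_eq_interactionEnergy {N : ℕ} (x : Fin N → EuclideanSpace ℝ (Fin 3))
    (Ω : Finset (Fin N)) :
    ∑ i ∈ Ω, (1 / 2 : ℝ) * (∑ j ∈ Ω.erase i, lennardJones (dist (x i) (x j))) =
      interactionEnergy lennardJones (x ∘ (Ω.orderEmbOfFin rfl).toEmbedding) := by
  classical
  set e := (Ω.orderEmbOfFin rfl).toEmbedding with he
  have hU : Finset.univ.map e = Ω := Finset.map_orderEmbOfFin_univ Ω rfl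
  have hD := stub_decomp lennardJones N Ω.card x e
  rw [hU] at hD
  -- the full site sums split into self + cross; compare with `stub_decomp`
  have hsplit : ∑ i ∈ Ω, (1 / 2 : ℝ) * (∑ j ∈ Finset.univ.erase i, lennardJones (dist (x i) (x j))) =
      ∑ i ∈ Ω, (1 / 2 : ℝ) * (∑ j ∈ Ω.erase i, lennardJones (dist (x i) (x j))) +
        (1 / 2 : ℝ) * ∑ i ∈ Ω, ∑ j ∈ Finset.univ.filter (fun j => j ∉ Ω),
          lennardJones (dist (x i) (x j)) := by
    rw [Finset.mul_sum, ← Finset.sum_add_distrib]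
    refine Finset.sum_congr rfl fun i hi => ?_
    rw [pnf_sum_erase_split Ω hi, mul_add]
  have hcross : ∑ k : Fin Ω.card, ∑ j ∈ Ωᶜ, lennardJones (dist (x (e k)) (x j)) =
      ∑ i ∈ Ω, ∑ j ∈ Finset.univ.filter (fun j => j ∉ Ω), lennardJones (dist (x i) (x j)) := by
    have h1 : (Ωᶜ : Finset (Fin N)) = Finset.univ.filter (fun j => j ∉ Ω) := by
      ext j; simp
    have h2 : ∑ k : Fin Ω.card, ∑ j ∈ Ωᶜ, lennardJones (dist (x (e k)) (x j)) =
        ∑ i ∈ Finset.univ.map e, ∑ j ∈ Ωᶜ, lennardJones (dist (x i) (x j)) :=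
      (Finset.sum_map Finset.univ e (fun i => ∑ j ∈ Ωᶜ, lennardJones (dist (x i) (x j)))).symm
    rw [h2, hU, h1]
  rw [hcross] at hD
  linarith

/-- **Self-energy floor** (periodisation): for a `δ`-separated configuration and any `Ω`,
`0 ≤ Σ_{i∈Ω} ½Σ_{j∈Ω∖i} V_LJ − #Ω · e*`. [folklore] -/
theorem pureNearField_self_floor {N : ℕ} (x : Fin N → EuclideanSpace ℝ (Fin 3)) {δ : ℝ} (hδ : 0 < δ)
    (hsep : ∀ i j : Fin N, i ≠ j → δ ≤ dist (x i) (x j)) (Ω : Finset (Fin N)) :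
    0 ≤ (∑ i ∈ Ω, (1 / 2 : ℝ) * (∑ j ∈ Ω.erase i, lennardJones (dist (x i) (x j)))) -
      (Ω.card : ℝ) * (⨅ Q : PeriodicConfiguration 3, Q.energyPerParticle lennardJones) := by
  rw [pnf_self_eq_interactionEnergy]
  have hinj : Function.Injective (x ∘ (Ω.orderEmbOfFin rfl).toEmbedding) :=
    (injective_of_separated hδ hsep).comp (Ω.orderEmbOfFin rfl).toEmbedding.injective
  have h := card_mul_iInf_le_interactionEnergy hinj
  linarith

/-- **Cross-term floor.**  Given the interface lemma (constant `K`), for `δ`-separated `x` and a set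
`Ω` of good particles the cross terms with `Ωᶜ` satisfy
`Σ_{i∈Ω} Σ_{j∉Ω} V_LJ(|x i − x j|) ≥ −((250/6)δ⁻⁶ + |K|/6)·#∂₄Ω`. [folklore] -/
theorem pnf_cross_floor {N : ℕ} (x : Fin N → EuclideanSpace ℝ (Fin 3)) {δ K : ℝ} (hδ : 0 < δ)
    (hsep : ∀ i j : Fin N, i ≠ j → δ ≤ dist (x i) (x j)) (Ω : Finset (Fin N))
    (hK : (∑ i ∈ Ω.filter (fun i => ∀ j : Fin N, dist (x j) (x i) ≤ 4 → j ∈ Ω),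
        ∑ j ∈ Finset.univ.filter (fun j => j ∉ Ω), (dist (x i) (x j))⁻¹ ^ 6) ≤
      K * (Nat.card {i : Fin N // i ∈ Ω ∧ ∃ j : Fin N, j ∉ Ω ∧ dist (x j) (x i) ≤ 4} : ℝ)) :
    -((250 / 6 * δ⁻¹ ^ 6 + |K| / 6) *
        (Nat.card {i : Fin N // i ∈ Ω ∧ ∃ j : Fin N, j ∉ Ω ∧ dist (x j) (x i) ≤ 4} : ℝ)) ≤
      ∑ i ∈ Ω, ∑ j ∈ Finset.univ.filter (fun j => j ∉ Ω), lennardJones (dist (x i) (x j)) := by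
  classical
  set E : Finset (Fin N) := Finset.univ.filter (fun j => j ∉ Ω) with hE
  set I : Finset (Fin N) := Ω.filter (fun i => ∀ j : Fin N, dist (x j) (x i) ≤ 4 → j ∈ Ω) with hI
  set B : Finset (Fin N) := Ω.filter (fun i => ∃ j : Fin N, j ∉ Ω ∧ dist (x j) (x i) ≤ 4) with hB
  set G : ℝ := (Nat.card {i : Fin N // i ∈ Ω ∧ ∃ j : Fin N, j ∉ Ω ∧ dist (x j) (x i) ≤ 4} : ℝ) with hG
  have hGB : G = (B.card : ℝ) := by
    rw [hG, Nat.card_eq_fintype_card, Fintype.card_subtype]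
    congr 2
    ext i
    simp [hB, Finset.mem_filter]
  have hG0 : 0 ≤ G := by rw [hG]; exact Nat.cast_nonneg _
  -- termwise: `V ≥ −r⁻⁶/6`
  have hterm : ∀ i : Fin N, -(1 / 6) * ∑ j ∈ E, (dist (x i) (x j))⁻¹ ^ 6 ≤
      ∑ j ∈ E, lennardJones (dist (x i) (x j)) := by
    intro i
    rw [Finset.mul_sum]
    refine Finset.sum_le_sum fun j _ => ?_
    have := neg_inv_pow_six_le_lennardJones (dist (x i) (x j))
    linarith
  -- boundary sites: shell sum
  have hbdry : ∀ i ∈ Ω, -(250 / 6 * δ⁻¹ ^ 6) ≤ ∑ j ∈ E, lennardJones (dist (x i) (x j)) := by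
    intro i hi
    have hsub : E ⊆ Finset.univ.erase i := by
      intro j hj
      rw [Finset.mem_erase]
      exact ⟨fun h => (Finset.mem_filter.1 hj).2 (h ▸ hi), Finset.mem_univ j⟩
    have h1 : ∑ j ∈ E, (dist (x i) (x j))⁻¹ ^ 6 ≤ ∑ j ∈ Finset.univ.erase i, (dist (x i) (x j))⁻¹ ^ 6 :=
      Finset.sum_le_sum_of_subset_of_nonneg hsub fun j _ _ => by positivity
    have h2 := sum_inv_pow_six_le x hδ hsep i
    have h3 := hterm i
    nlinarith
  -- split `Ω = I ∪ B`
  have hsplit : ∑ i ∈ Ω, ∑ j ∈ E, lennardJones (dist (x i) (x j)) =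
      ∑ i ∈ I, ∑ j ∈ E, lennardJones (dist (x i) (x j)) +
        ∑ i ∈ B, ∑ j ∈ E, lennardJones (dist (x i) (x j)) := by
    rw [hI, hB, ← Finset.sum_filter_add_sum_filter_not Ω
      (fun i => ∀ j : Fin N, dist (x j) (x i) ≤ 4 → j ∈ Ω)]
    congr 1
    refine Finset.sum_congr ?_ fun _ _ => rfl
    refine Finset.filter_congr fun i _ => ?_
    push Not
    constructor
    · rintro ⟨j, hd, hj⟩; exact ⟨j, hj, hd⟩
    · rintro ⟨j, hj, hd⟩; exact ⟨j, hd, hj⟩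
  have hIsum : -(1 / 6) * (K * G) ≤ ∑ i ∈ I, ∑ j ∈ E, lennardJones (dist (x i) (x j)) := by
    have h1 : ∑ i ∈ I, (-(1 / 6) * ∑ j ∈ E, (dist (x i) (x j))⁻¹ ^ 6) ≤
        ∑ i ∈ I, ∑ j ∈ E, lennardJones (dist (x i) (x j)) :=
      Finset.sum_le_sum fun i _ => hterm i
    rw [← Finset.mul_sum] at h1
    have h2 : -(1 / 6) * (K * G) ≤ -(1 / 6) * ∑ i ∈ I, ∑ j ∈ E, (dist (x i) (x j))⁻¹ ^ 6 :=
      mul_le_mul_of_nonpos_left hK (by norm_num)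
    exact h2.trans h1
  have hBsum : -(250 / 6 * δ⁻¹ ^ 6) * (B.card : ℝ) ≤ ∑ i ∈ B, ∑ j ∈ E, lennardJones (dist (x i) (x j)) := by
    have h : ∑ _i ∈ B, (-(250 / 6 * δ⁻¹ ^ 6)) ≤ ∑ i ∈ B, ∑ j ∈ E, lennardJones (dist (x i) (x j)) :=
      Finset.sum_le_sum fun i hi => hbdry i (Finset.mem_filter.1 hi).1
    rw [Finset.sum_const, nsmul_eq_mul] at h
    linarith
  have hKabs : -(|K| * G) ≤ -(K * G) :=
    neg_le_neg (mul_le_mul_of_nonneg_right (le_abs_self K) hG0)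
  rw [hsplit, hGB] at *
  nlinarith [hIsum, hBsum, hKabs, hG0]

/-- The site-energy sum over `Ω` splits into the self part, the `e*` part and half the cross
terms. [folklore] -/
theorem pnf_siteSum_split {N : ℕ} (x : Fin N → EuclideanSpace ℝ (Fin 3)) (Ω : Finset (Fin N)) :
    ∑ i ∈ Ω, ((1 / 2 : ℝ) * (∑ j ∈ Finset.univ.erase i, lennardJones (dist (x i) (x j))) -
      (⨅ Q : PeriodicConfiguration 3, Q.energyPerParticle lennardJones)) =
      (∑ i ∈ Ω, (1 / 2 : ℝ) * (∑ j ∈ Ω.erase i, lennardJones (dist (x i) (x j)))) -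
        (Ω.card : ℝ) * (⨅ Q : PeriodicConfiguration 3, Q.energyPerParticle lennardJones) +
      (1 / 2 : ℝ) * ∑ i ∈ Ω, ∑ j ∈ Finset.univ.filter (fun j => j ∉ Ω),
        lennardJones (dist (x i) (x j)) := by
  have h1 : ∑ i ∈ Ω, ((1 / 2 : ℝ) * (∑ j ∈ Finset.univ.erase i, lennardJones (dist (x i) (x j))) -
      (⨅ Q : PeriodicConfiguration 3, Q.energyPerParticle lennardJones)) =
      ∑ i ∈ Ω, (1 / 2 : ℝ) * (∑ j ∈ Finset.univ.erase i, lennardJones (dist (x i) (x j))) -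
        (Ω.card : ℝ) * (⨅ Q : PeriodicConfiguration 3, Q.energyPerParticle lennardJones) := by
    rw [Finset.sum_sub_distrib, Finset.sum_const, nsmul_eq_mul]
  have h2 : ∑ i ∈ Ω, (1 / 2 : ℝ) * (∑ j ∈ Finset.univ.erase i, lennardJones (dist (x i) (x j))) =
      ∑ i ∈ Ω, (1 / 2 : ℝ) * (∑ j ∈ Ω.erase i, lennardJones (dist (x i) (x j))) +
        ∑ i ∈ Ω, (1 / 2 : ℝ) * ∑ j ∈ Finset.univ.filter (fun j => j ∉ Ω),
          lennardJones (dist (x i) (x j)) := by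
    rw [← Finset.sum_add_distrib]
    refine Finset.sum_congr rfl fun i hi => ?_
    rw [pnf_sum_erase_split Ω hi, mul_add]
  have h3 : ∑ i ∈ Ω, (1 / 2 : ℝ) * ∑ j ∈ Finset.univ.filter (fun j => j ∉ Ω),
        lennardJones (dist (x i) (x j)) =
      (1 / 2 : ℝ) * ∑ i ∈ Ω, ∑ j ∈ Finset.univ.filter (fun j => j ∉ Ω),
        lennardJones (dist (x i) (x j)) := by
    rw [Finset.mul_sum]
  linarith

/-- **Boundary floor** (the `c = 0` shadow of the crux, given the interface lemma): for every
`δ > 0` there is `C` with `Σ_{i∈Ω}(e_i − e*) ≥ −C·#∂₄Ω` for every `δ`-separated `x` and every set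
`Ω` of good particles. [folklore] -/
theorem boundaryFloor
    (hIL : ∀ δ : ℝ, 0 < δ → ∃ K : ℝ, ∀ (N : ℕ) (x : Fin N → EuclideanSpace ℝ (Fin 3)),
      (∀ i j : Fin N, i ≠ j → δ ≤ dist (x i) (x j)) →
      ∀ Ω : Finset (Fin N), (∀ i ∈ Ω, IsTwoShellGood (1 / 20) (47 / 50) 1 x i) →
        (∑ i ∈ Ω.filter (fun i => ∀ j : Fin N, dist (x j) (x i) ≤ 4 → j ∈ Ω),
            ∑ j ∈ Finset.univ.filter (fun j => j ∉ Ω), (dist (x i) (x j))⁻¹ ^ 6) ≤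
          K * (Nat.card {i : Fin N // i ∈ Ω ∧ ∃ j : Fin N, j ∉ Ω ∧ dist (x j) (x i) ≤ 4} : ℝ)) :
    ∀ δ : ℝ, 0 < δ → ∃ C : ℝ, ∀ (N : ℕ) (x : Fin N → EuclideanSpace ℝ (Fin 3)),
      (∀ i j : Fin N, i ≠ j → δ ≤ dist (x i) (x j)) →
      ∀ Ω : Finset (Fin N), (∀ i ∈ Ω, IsTwoShellGood (1 / 20) (47 / 50) 1 x i) →
        -(C * (Nat.card {i : Fin N // i ∈ Ω ∧ ∃ j : Fin N, j ∉ Ω ∧ dist (x j) (x i) ≤ 4} : ℝ)) ≤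
          ∑ i ∈ Ω, ((1 / 2 : ℝ) * (∑ j ∈ Finset.univ.erase i, lennardJones (dist (x i) (x j))) -
            (⨅ Q : PeriodicConfiguration 3, Q.energyPerParticle lennardJones)) := by
  intro δ hδ
  obtain ⟨K, hK⟩ := hIL δ hδ
  refine ⟨250 / 12 * δ⁻¹ ^ 6 + |K| / 12, fun N x hsep Ω hΩ => ?_⟩
  have hcross := pnf_cross_floor x hδ hsep Ω (hK N x hsep Ω hΩ)
  have hself := pureNearField_self_floor x hδ hsep Ω
  rw [pnf_siteSum_split x Ω]
  nlinarith [hcross, hself]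

/-- **Stub (reduction): the crux from its PURE NEAR-FIELD form and the interface lemma.**  If, for
`δ`-separated configurations and sets `Ω` of good particles, the SELF-energy excess
`Σ_{i∈Ω} ½Σ_{j∈Ω∖i} V_LJ − #Ω·e*` controls `c·#NL(Ω) − C·#∂₄Ω`, then so does the full site-energy
excess `Σ_{i∈Ω}(e_i − e*)` (with `C` enlarged by `(250/12)δ⁻⁶ + |K(δ)|/12`): the cross terms with
`Ωᶜ` are boundary-summable (`pnf_cross_floor`). -/
theorem stub_cruxOfPureNearField
    (hIL : ∀ δ : ℝ, 0 < δ → ∃ K : ℝ, ∀ (N : ℕ) (x : Fin N → EuclideanSpace ℝ (Fin 3)),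
      (∀ i j : Fin N, i ≠ j → δ ≤ dist (x i) (x j)) →
      ∀ Ω : Finset (Fin N), (∀ i ∈ Ω, IsTwoShellGood (1 / 20) (47 / 50) 1 x i) →
        (∑ i ∈ Ω.filter (fun i => ∀ j : Fin N, dist (x j) (x i) ≤ 4 → j ∈ Ω),
            ∑ j ∈ Finset.univ.filter (fun j => j ∉ Ω), (dist (x i) (x j))⁻¹ ^ 6) ≤
          K * (Nat.card {i : Fin N // i ∈ Ω ∧ ∃ j : Fin N, j ∉ Ω ∧ dist (x j) (x i) ≤ 4} : ℝ))
    (hPNF : ∀ δ : ℝ, 0 < δ → ∀ η : ℝ, 0 < η → ∃ c : ℝ, 0 < c ∧ ∃ C : ℝ, ∀ (N : ℕ) (x : Fin N → EuclideanSpace ℝ (Fin 3)), (∀ i j : Fin N, i ≠ j → δ ≤ dist (x i) (x j)) → ∀ Ω : Finset (Fin N), (∀ i ∈ Ω, IsTwoShellGood (1 / 20) (47 / 50) 1 x i) → c * (Nat.card {i : Fin N // i ∈ Ω ∧ ¬ (∃ (A : EuclideanSpace ℝ (Fin 3) →ₗᵢ[ℝ] EuclideanSpace ℝ (Fin 3))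 (t : EuclideanSpace ℝ (Fin 3)) (a : ℝ) (s : ℤ → ℤ) (z : ℤ → ℝ), 47 / 50 ≤ a ∧ a ≤ 1 ∧ IsHaggSeq s ∧ (∀ m : ℤ, 39 / 50 * a ≤ z (m + 1) - z m ∧ z (m + 1) - z m ≤ 17 / 20 * a) ∧ (fun S : Set (EuclideanSpace ℝ (Fin 3)) => (∀ j : Fin N, dist (x j) (x i) ≤ 2 → ∃ p ∈ S, dist (x j + t) p ≤ η) ∧ (∀ p ∈ S, dist p (x i + t) ≤ 2 → ∃ j : Fin N, dist (x j + t) p ≤ η)) {p | ∃ m i j : ℤ, p = A (((i : ℝ) • triangularVec₁ a) + ((j : ℝ) • triangularVec₂ a) + ((haggLabel s m : ℝ) • barlowOffset a) + (z m • layerNormal 1))})} : ℝ) - C * (Nat.card {i : Fin N // i ∈ Ω ∧ ∃ j : Fin N, j ∉ Ω ∧ dist (x j) (x i) ≤ 4} : ℝ) ≤ (∑ i ∈ Ω, (1 / 2 : ℝ) * (∑ j ∈ Ω.erase i, lennardJones (dist (x i) (x j)))) - (Ω.card : ℝ) * (⨅ Q : PeriodicConfiguration 3, Q.energyPerParticle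 lennardJones)) :
    ∀ δ : ℝ, 0 < δ → ∀ η : ℝ, 0 < η → ∃ c : ℝ, 0 < c ∧ ∃ C : ℝ, ∀ (N : ℕ) (x : Fin N → EuclideanSpace ℝ (Fin 3)), (∀ i j : Fin N, i ≠ j → δ ≤ dist (x i) (x j)) → ∀ Ω : Finset (Fin N), (∀ i ∈ Ω, IsTwoShellGood (1 / 20) (47 / 50) 1 x i) → c * (Nat.card {i : Fin N // i ∈ Ω ∧ ¬ (∃ (A : EuclideanSpace ℝ (Fin 3) →ₗᵢ[ℝ] EuclideanSpace ℝ (Fin 3)) (t : EuclideanSpace ℝ (Fin 3)) (a : ℝ) (s : ℤ → ℤ) (z : ℤ → ℝ), 47 / 50 ≤ a ∧ a ≤ 1 ∧ IsHaggSeq s ∧ (∀ m : ℤ, 39 / 50 * a ≤ z (m + 1) - z m ∧ z (m + 1) - z m ≤ 17 / 20 * a) ∧ (fun S : Set (EuclideanSpace ℝ (Fin 3)) => (∀ j : Fin N, dist (x j) (x i) ≤ 2 → ∃ p ∈ S, dist (x j + t) p ≤ η) ∧ (∀ p ∈ S, dist p (x i + t) ≤ 2 → ∃ j : Fin N, dist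 (x j + t) p ≤ η)) {p | ∃ m i j : ℤ, p = A (((i : ℝ) • triangularVec₁ a) + ((j : ℝ) • triangularVec₂ a) + ((haggLabel s m : ℝ) • barlowOffset a) + (z m • layerNormal 1))})} : ℝ) - C * (Nat.card {i : Fin N // i ∈ Ω ∧ ∃ j : Fin N, j ∉ Ω ∧ dist (x j) (x i) ≤ 4} : ℝ) ≤ ∑ i ∈ Ω, ((1 / 2 : ℝ) * (∑ j ∈ Finset.univ.erase i, lennardJones (dist (x i) (x j))) - (⨅ Q : PeriodicConfiguration 3, Q.energyPerParticle lennardJones)) := by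
  intro δ hδ η hη
  obtain ⟨K, hK⟩ := hIL δ hδ
  obtain ⟨c, hc, C, hC⟩ := hPNF δ hδ η hη
  refine ⟨c, hc, C + 250 / 12 * δ⁻¹ ^ 6 + |K| / 12, fun N x hsep Ω hΩ => ?_⟩
  have hcross := pnf_cross_floor x hδ hsep Ω (hK N x hsep Ω hΩ)
  have hmain := hC N x hsep Ω hΩ
  rw [pnf_siteSum_split x Ω]
  have hG0 : (0 : ℝ) ≤ (Nat.card {i : Fin N // i ∈ Ω ∧ ∃ j : Fin N, j ∉ Ω ∧ dist (x j) (x i) ≤ 4} : ℝ) :=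
    Nat.cast_nonneg _
  nlinarith [hcross, hmain, hG0]

end Summit.AtomisticToContinuum.Crystallization.Theorems.PhononSlackNearFieldConvexity
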